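import Summits.ResolutionOfSingularities.ResolutionOfSingularities.Theorems.JetCutClasses
import Summits.ResolutionOfSingularities.ResolutionOfSingularities.Theorems.JetCutTameClasses
import HarnessLib

/-!
# JetCutTameKernels2 — decomp-res node «JetCut» (lens-2 g15 rev 5), file 2/2 of `JetCutTameKernels`

Content VERBATIM from the decomp-res lens-2 file `HOME/decomp-res-lens-2/g15/JetCut.lean` rev 5 (pin 9f53e5ca =
`parts/JetCut-rev5-9f53e5ca.lean`, 7 495 l;
HOME = run/shared/lean/pub/decomp-res; CRITIC-LEDGER rows 109 / 115 / 120 / 121 / 122 / 127 / 133 CLEARED; landing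
order INBOX :231; the critic's
HYGIENE-landing.md h1–h11 applied — DOCSTRING-ONLY).  The lens's blocks RESTATED VERBATIM from lens-2 g12 / g13 /
g14 (§R / §R13 / §R14) are DELETED:
they are the tree's `RelativeDeltaCut*` / `CurveLeafExit*` / `PinchCut*` modules (namespaces `RelativeDeltaCut`,
`CurveLeafExit`, `PinchCut`, opened;
the lens's `CurveLeafExitRestated.x` / `PinchCutRestated.x` are cited as `CurveLeafExit.x` / `PinchCut.x`, the three
pointwise engine edges of g12 as
`RelativeDeltaCut.x`).  Namespace `…Theorems.JetCut` (the lens's `Theses.JetCut` is gate-reserved), sub-namespaces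
`Tame` / `Wide` / `Broad` / `Vast`
as in the lens; file split only (tree files ≤ 400 lines): sections, variables and every declaration exactly as in
the lens, the long rev-0/1 prose
lives in HOME/decomp-res-lens-2/g15/NODE-g15.md §ARCHIVE-A (not in the tree).  Node files, in import order:
`JetCutJetKernels`, `JetCutPoint`, `JetCutClasses`, `JetCutKernels`, `JetCutTame`, `JetCutTameClasses`,
`JetCutTameKernels`, `JetCutLadder`, `JetCutWideClasses`, `JetCutWideKernels`, `JetCutMixed`, `JetCutBroadClasses`,
`JetCutBroadKernels`, `JetCutDegenerate`, `JetCutVastClasses`, `JetCutVastKernels`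
(each possibly continued `…2`, `…3`), then the wiring `MaxContactCutJetCut*` (in the Theses cone).  All `--supports
stmt-ResolutionOfSingularities-29273`
(`MaxContactCut.RungOne`); nothing closes 29273 — decided cells carry their engines as hypotheses, and exactly ONE
located-residual aside is booked on
the route for this column (`Vast.VastSpecialRung`, home `JetCutVastClasses`).

§TK (namespace `Tame`) + the route-free refinement edges tame → jet: pure-logic KERNELS of the TAME cut (mechanical
copy of §K: exhaustion, projections, EXACT `Tame.seqDimFour_one_iff`, strata cuts, engine kernels at a point,
`Tame.tGenRungAt_of_engines`, `Tame.tameGenericRung_of_engines`, `flatConeExit_of_jetTameExit`) — VERBATIM, 0 sorry;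
`Tame.rungOne_iff` / `Tame.closes*` / edges naming route items are in `MaxContactCutJetCut*`.  [Writer: the lens's
two mechanical re-proofs `Tame.isCurveExitPt_of_isJetTameCurvePt` / `Tame.not_isTameSpecialPt_of_isJetTameCurvePt` —
the SAME statements as the §T2 originals in the enclosing namespace — are not repeated (the gate's dedup.landed lint
forbids restating a landed declaration); every use resolves to the original by namespace resolution, proofs unchanged.]

Part 2/2 carries: `tameSpecialRung_of_jetSpecialRung`, `jetGenericRung_of_tameGenericRung`.

(Sources: HunekeSwanson2006 Cor. 5.5.5; CossartJannsenSaito2020 Ch. 2, Thm. 3.6/3.7, Ch. 8; CossartPiltant2008 Prop.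
4.2; CossartPiltant2019 Rem. 3.2; Hironaka1964 Ch. III; Hironaka1967; Hironaka1977; Moh1987; Giraud1975.)
-/

open CategoryTheory AlgebraicGeometry TopologicalSpace IsLocalRing
open Literature.AlgebraicGeometry.Resolution
open Summit.ResolutionOfSingularities.ResolutionOfSingularities.Theorems
open Summit.ResolutionOfSingularities.ResolutionOfSingularities.Theorems.WeakOrderReduction
open Summit.ResolutionOfSingularities.ResolutionOfSingularities.Theorems.DeltaFaceCutClasses
open Summit.ResolutionOfSingularities.ResolutionOfSingularities.Theorems.RelativeDeltaCut
open Summit.ResolutionOfSingularities.ResolutionOfSingularities.Theorems.CurveLeafExit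
open Summit.ResolutionOfSingularities.ResolutionOfSingularities.Theorems.PinchCut

namespace Summit.ResolutionOfSingularities.ResolutionOfSingularities.Theorems.JetCut

namespace Tame

/-! ### Refinement edges of the tame cut to rev 0's jet cut (BY NAME) -/

/-- rev 0's located residual implies the tame residual (the residual SHRINKS: weaker statement). [folklore] -/
theorem tameSpecialRung_of_jetSpecialRung (h : JetSpecialRung) : TameSpecialRung := by
  intro hE2 n hn p hp k _ _ Y g h1 h2 h3 hY h4 I hord hex
  obtain ⟨y, hy, hs⟩ := hex
  exact h hE2 n hn p hp k Y g h1 h2 h3 hY h4 I hord ⟨y, hy, isJetSpecialPt_of_isTameSpecialPt hs⟩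

/-- The tame decided half implies rev 0's decided half. [folklore] -/
theorem jetGenericRung_of_tameGenericRung (h : TameGenericRung) : JetGenericRung := by
  intro hE2 n hn p hp k _ _ Y g h1 h2 h3 hY h4 I hord hcls
  refine h hE2 n hn p hp k Y g h1 h2 h3 hY h4 I hord ?_
  intro y hy
  rcases hcls y hy with h' | h' | h' | h' | h' | h' | h' | h' | h'
  · exact Or.inl h'
  · exact Or.inr (Or.inl h')
  · exact Or.inr (Or.inr (Or.inl h'))
  · exact Or.inr (Or.inr (Or.inr (Or.inl h')))
  · exact Or.inr (Or.inr (Or.inr (Or.inr (Or.inl h'))))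
  · exact Or.inr (Or.inr (Or.inr (Or.inr (Or.inr (Or.inl h')))))
  · exact Or.inr (Or.inr (Or.inr (Or.inr (Or.inr (Or.inr (Or.inl h'))))))
  · exact Or.inr (Or.inr (Or.inr (Or.inr (Or.inr (Or.inr (Or.inr (Or.inl h')))))))
  · exact Or.inr (Or.inr (Or.inr (Or.inr (Or.inr (Or.inr (Or.inr (Or.inr (isJetTameCurvePt_of_isJetCurvePt h'))))))))

end Tame

end Summit.ResolutionOfSingularities.ResolutionOfSingularities.Theorems.JetCut
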